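import Literature.Analysis.FluidPDE.WeakSolution
import Mathlib.Analysis.SpecialFunctions.Trigonometric.Inverse
import HarnessLib

/-!
# Backward uniqueness for the heat operator in cones of opening `> 2 arccos(1/√3)`
# (Li–Šverák 2012, Thm. 1.1)

Topic `Literature/Analysis/FluidPDE` (cite item wi-39734; fallback engine for line `radon_topside` of
crux `stmt-NavierStokesRegularity-16921`: it weakens that line's half-space window to a cone window).
ONE named fact, rendered exactly like the accepted half-space case
`Literature.Analysis.FluidPDE.ess_backward_uniqueness` (`NSLerayHopfProofs.lean`; ESS 2003 Thm. 5.1,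
`θ = π`), plus proved bookkeeping.

## What is printed (held text `paper:arxiv-1011.2796`)

§1: for an open `Ω ⊂ ℝⁿ` and the equation (1.1) `u_t - Δu + b(x,t)·∇u + c(x,t) u = 0` with `b, c`
measurable and bounded, "(BU) If a bounded `u : Ω × (0,T) → ℝ` satisfies (1.1) and `u(·, T) = 0`,
then `u ≡ 0` in `Ω × (0,T)`" — "no assumptions are made about `u` at the parabolic boundary
`∂Ω × (0,T) ∪ (Ω × {0})`"; the cones are `𝒪_θ = {x = (x₁, x') : x₁ > |x| cos(θ/2)}`; "Escauriaza [E]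
recently showed that (BU) fails when `θ < π/2`".

> **Theorem 1.1.** The cones `𝒪_θ` satisfy (BU) for `θ > 2 arccos(1/√3) ∼ 109.52°`.

"In what follows we will work with the inequality `|u_t - Δu| ≤ c₁(|∇u| + |u|)` rather than (1.1) …
when assuming the boundedness of `b` and `c`, the two formulations are equivalent."  §2 (the form
that is proved, `T = 1`, time reversed): "Suppose that `u(x,t)` is a solution to the backward heat
equation for some `θ > 2 arccos(1/√3)`: `|u_t + Δu| ≤ c₁(|∇u| + |u|)` in `𝒪_θ × (0,1)`, `u(·,0) = 0`
in `𝒪_θ`. In addition, `|u| < M` in `𝒪_θ × (0,1)`. Then `u ≡ 0`."  (Lemma 2.4 + Prop. 2.3 treat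
`θ ∈ (2 arccos(1/√3), π)`; `θ = π` is the half-space [ESS].)

## Rendering (special case of the print, as for `ess_backward_uniqueness`)

* SCALAR `u` (as printed: `u : Ω × (0,T) → ℝ`), any dimension `n`, the cone with axis a unit vector
  `e` (LS: `e = e₁`): `𝒪_θ(e) = {x | ‖x‖ cos(θ/2) < ⟪x, e⟫}`, opening `2 arccos(1/√3) < θ ≤ π`.
  `-- TODO(general form): systems u : ℝⁿ → ℝᵐ (same Carleman proof; printed only for ESS's half-space).`
* Time first, backward form on `(0,1)` (§2), `u` jointly `C²` on the open cylinder and continuous up to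
  the slice `t = 0` where it vanishes, with the local square-integrability of `u, ∂ₜu, ∇²u` over
  bounded subsets of the cylinder ((5.4) of ESS, the regularity their Carleman lemmas use) — every such
  `u` obeying the differential inequality is a bounded solution of an equation (1.1) with bounded
  measurable `b, c`, so this is a SPECIAL CASE of Theorem 1.1 (hypotheses only added, never removed).
* `|u| < M` rendered `‖u t x‖ ≤ M` (equivalent up to changing `M`).

## Main statements

* `openingThreshold = 2 arccos(1/√3)` and `openingThreshold_lt_two_pi_div_three` (PROVED: the `120°`
  cone is admissible, `cos(π/3) = 1/2 < 1/√3`); `cone`, `cone_pi` (PROVED: `θ = π` is the half-space),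
  `cone_mono` (PROVED: `cos(θ'/2) ≤ cos(θ/2) → 𝒪_θ ⊆ 𝒪_θ'`, the monotonicity behind LS's remark that
  (BU) passes to larger domains).
* `LiSverak2012_backwardUniqueness_cone` — the NAMED FACT (Thm. 1.1, backward form of §2).
* `LiSverak2012_backwardUniqueness_cone.halfSpace_bounded` — PROVED corollary: the half-space case
  (`θ = π`) for bounded `u`, i.e. ESS Thm. 5.1 with (5.3) replaced by boundedness.

## References

* Lu Li, V. Šverák, *Backward uniqueness for the heat equation in cones*, Comm. Partial Differential
  Equations 37 (2012) 1414–1429 = arXiv:1011.2796, §1 ((BU), Thm. 1.1, Escauriaza's example), §2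
  (backward form, Lemma 2.4). [LiSverak2012]
* L. Escauriaza, G. Seregin, V. Šverák, Russian Math. Surveys 58 (2003) 211–250, Thm. 5.1.
  [EscauriazaSereginSverak2003]
-/

noncomputable section

open MeasureTheory Set Function Real
open scoped InnerProductSpace RealInnerProductSpace ENNReal NNReal Laplacian

namespace Literature.Analysis.FluidPDE

namespace LiSverak

/-- The critical opening of Li–Šverák: `θ* = 2 arccos(1/√3) ≈ 109.52°`. [cite: LiSverak2012, Thm. 1.1] -/
def openingThreshold : ℝ := 2 * arccos (1 / √3)

/-- The open cone of opening angle `θ` with axis the (unit) vector `e`: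
`𝒪_θ(e) = {x | ‖x‖ cos(θ/2) < ⟪x, e⟫}` (Li–Šverák: `e = e₁`, `𝒪_θ = {x₁ > |x| cos(θ/2)}`).
[cite: LiSverak2012, §1 (definition of 𝒪_θ)] -/
def cone {n : ℕ} (θ : ℝ) (e : EuclideanSpace ℝ (Fin n)) : Set (EuclideanSpace ℝ (Fin n)) :=
  {x | ‖x‖ * Real.cos (θ / 2) < ⟪x, e⟫_ℝ}

/-- Membership in the cone, unfolded. [folklore] -/
@[simp] theorem mem_cone {n : ℕ} {θ : ℝ} {e x : EuclideanSpace ℝ (Fin n)} :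
    x ∈ cone θ e ↔ ‖x‖ * Real.cos (θ / 2) < ⟪x, e⟫_ℝ := Iff.rfl

/-- `θ = π` is the half-space `{0 < ⟪x, e⟫}` of ESS Thm. 5.1. [folklore] -/
theorem cone_pi {n : ℕ} (e : EuclideanSpace ℝ (Fin n)) : cone π e = {x | 0 < ⟪x, e⟫_ℝ} := by
  ext x
  simp [cone, Real.cos_pi_div_two]

/-- The cones increase with the opening: if `cos(θ'/2) ≤ cos(θ/2)` then `𝒪_θ ⊆ 𝒪_θ'` ("if
`Ω₁ ⊂ Ω₂` and `Ω₁` satisfies (BU), then also `Ω₂`"). [cite: LiSverak2012, §1] -/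
theorem cone_mono {n : ℕ} {θ θ' : ℝ} (h : Real.cos (θ' / 2) ≤ Real.cos (θ / 2))
    (e : EuclideanSpace ℝ (Fin n)) : cone θ e ⊆ cone θ' e := fun x hx =>
  lt_of_le_of_lt (mul_le_mul_of_nonneg_left h (norm_nonneg x)) hx

/-- **The `120°` cone is admissible**: `2 arccos(1/√3) < 2π/3`, because `cos(π/3) = 1/2 < 1/√3` and
`arccos` is strictly decreasing. [folklore] -/
theorem openingThreshold_lt_two_pi_div_three : openingThreshold < 2 * π / 3 := by
  have h3 : (1 : ℝ) < √3 := by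
    rw [show (1 : ℝ) = √1 from Real.sqrt_one.symm]
    exact Real.sqrt_lt_sqrt zero_le_one (by norm_num)
  have h3' : √3 < 2 := by
    rw [show (2 : ℝ) = √4 from by rw [show (4 : ℝ) = 2 ^ 2 by norm_num, Real.sqrt_sq zero_le_two]]
    exact Real.sqrt_lt_sqrt (by norm_num) (by norm_num)
  have hpos : (0 : ℝ) < √3 := one_pos.trans h3
  have hlt : (1 : ℝ) / 2 < 1 / √3 := by
    rw [div_lt_div_iff_of_pos_left one_pos two_pos hpos]
    exact h3'
  have hle : 1 / √3 ≤ 1 := by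
    rw [div_le_one hpos]
    exact h3.le
  have key : arccos (1 / √3) < arccos (1 / 2) := arccos_lt_arccos (by norm_num) hlt hle
  rw [show arccos (1 / 2 : ℝ) = π / 3 from by
    rw [← cos_pi_div_three, arccos_cos (by positivity) (by linarith [pi_pos])]] at key
  unfold openingThreshold
  linarith

end LiSverak

open LiSverak

/-- **Backward uniqueness for the heat operator in cones (Li–Šverák 2012, Thm. 1.1)**, *smooth
special case*, backward form of their §2.  Let `e` be a unit vector of `ℝⁿ`, `θ` an opening with
`2 arccos(1/√3) < θ ≤ π`, `𝒪 = 𝒪_θ(e) = {x | ‖x‖ cos(θ/2) < ⟪x, e⟫}` and `Q = 𝒪 × ]0, 1[`.  Let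
`u : Q → ℝ` be jointly `C²` on `Q` and continuous up to the slice `t = 0`, with `u`, `∂ₜu`, `∇²u`
square integrable over bounded (measurable) subsets of `Q`, and suppose
`|∂ₜu + Δu| ≤ c₁ (|∇u| + |u|)` in `Q` (backward heat operator with bounded lower-order terms),
`|u| ≤ M` in `Q` (BOUNDED — no growth allowed, unlike the half-space case), and `u(·, 0) = 0` in `𝒪`.
Then `u ≡ 0` in `Q`.  No assumption is made on `u` at the lateral boundary of the cone.  Li–Šverák
prove (BU) for all bounded solutions of `u_t - Δu + b·∇u + cu = 0` with bounded measurable `b, c`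
("equivalent" to the differential inequality), of which this `C²` version is a special case; the
threshold is their `θ₀ ≤ 2 arccos(1/√3) ≈ 109.52°` (and (BU) FAILS for `θ < π/2`, Escauriaza).
Time first: `u : ℝ → ℝⁿ → ℝ`.  Named fact (D-0014); users take `(h : LiSverak2012_backwardUniqueness_cone)`.
[cite: LiSverak2012, Thm. 1.1 and §2] -/
def LiSverak2012_backwardUniqueness_cone : Prop :=
  ∀ (n : ℕ) (e : EuclideanSpace ℝ (Fin n)) (_he : ‖e‖ = 1) (θ : ℝ) (_hθ : openingThreshold < θ)
    (_hθ' : θ ≤ π) (u : ℝ → EuclideanSpace ℝ (Fin n) → ℝ) (c₁ M : ℝ),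
    ContDiffOn ℝ 2 (uncurry u) (Ioo 0 1 ×ˢ cone θ e) →
    ContinuousOn (uncurry u) (Ico 0 1 ×ˢ cone θ e) →
    (∀ K ⊆ Ioo (0 : ℝ) 1 ×ˢ cone θ e, Bornology.IsBounded K → MeasurableSet K →
      ∫⁻ z in K, (‖u z.1 z.2‖ₑ ^ 2 + ‖timeDeriv u z.1 z.2‖ₑ ^ 2 +
        ‖iteratedFDeriv ℝ 2 (u z.1) z.2‖ₑ ^ 2) < ∞) →
    (∀ t ∈ Ioo (0 : ℝ) 1, ∀ x ∈ cone θ e,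
      ‖timeDeriv u t x + Δ (u t) x‖ ≤ c₁ * (‖fderiv ℝ (u t) x‖ + ‖u t x‖)) →
    (∀ t ∈ Ioo (0 : ℝ) 1, ∀ x ∈ cone θ e, ‖u t x‖ ≤ M) →
    (∀ x ∈ cone θ e, u 0 x = 0) →
    ∀ t ∈ Ioo (0 : ℝ) 1, ∀ x ∈ cone θ e, u t x = 0

-- TODO(general form): systems `u : ℝⁿ → ℝᵐ` and bounded weak solutions (printed generality of (BU)).

/-- **The half-space case for bounded `u`** (`θ = π`, Li–Šverák's remark that `ℝⁿ₊` satisfies (BU),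
[ESS]): from the fact, backward uniqueness in `{0 < ⟪x, e⟫} × ]0,1[` for bounded `C²` `u` — ESS
Thm. 5.1 with the growth condition (5.3) replaced by boundedness. [cite: LiSverak2012, Thm. 1.1] -/
theorem LiSverak2012_backwardUniqueness_cone.halfSpace_bounded
    (h : LiSverak2012_backwardUniqueness_cone) {n : ℕ} (e : EuclideanSpace ℝ (Fin n)) (he : ‖e‖ = 1)
    (u : ℝ → EuclideanSpace ℝ (Fin n) → ℝ) (c₁ M : ℝ)
    (h2 : ContDiffOn ℝ 2 (uncurry u) (Ioo 0 1 ×ˢ {x | 0 < ⟪x, e⟫_ℝ}))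
    (h0 : ContinuousOn (uncurry u) (Ico 0 1 ×ˢ {x | 0 < ⟪x, e⟫_ℝ}))
    (hL2 : ∀ K ⊆ Ioo (0 : ℝ) 1 ×ˢ {x : EuclideanSpace ℝ (Fin n) | 0 < ⟪x, e⟫_ℝ},
      Bornology.IsBounded K → MeasurableSet K →
      ∫⁻ z in K, (‖u z.1 z.2‖ₑ ^ 2 + ‖timeDeriv u z.1 z.2‖ₑ ^ 2 +
        ‖iteratedFDeriv ℝ 2 (u z.1) z.2‖ₑ ^ 2) < ∞)
    (hineq : ∀ t ∈ Ioo (0 : ℝ) 1, ∀ x : EuclideanSpace ℝ (Fin n), 0 < ⟪x, e⟫_ℝ →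
      ‖timeDeriv u t x + Δ (u t) x‖ ≤ c₁ * (‖fderiv ℝ (u t) x‖ + ‖u t x‖))
    (hbdd : ∀ t ∈ Ioo (0 : ℝ) 1, ∀ x : EuclideanSpace ℝ (Fin n), 0 < ⟪x, e⟫_ℝ → ‖u t x‖ ≤ M)
    (hinit : ∀ x : EuclideanSpace ℝ (Fin n), 0 < ⟪x, e⟫_ℝ → u 0 x = 0) :
    ∀ t ∈ Ioo (0 : ℝ) 1, ∀ x : EuclideanSpace ℝ (Fin n), 0 < ⟪x, e⟫_ℝ → u t x = 0 := by
  have hθ : openingThreshold < π := by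
    have := openingThreshold_lt_two_pi_div_three
    linarith [pi_pos]
  have key := h n e he π hθ le_rfl u c₁ M
  simp only [cone_pi] at key
  exact key h2 h0 hL2 (fun t ht x hx => hineq t ht x hx) (fun t ht x hx => hbdd t ht x hx)
    (fun x hx => hinit x hx)

end Literature.Analysis.FluidPDE

end
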